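import Summits.QuantumFields.YangMills.Theorems.LuscherReductionTwistedTraceScalingGaugeActionBased
import HarnessLib

/-!
# (C5-α, S5′) LINEARISATION OF THE RELATIVE COORDINATE UNDER A SMALL GAUGE TRANSFORMATION, WITH THE MEAN OF THE PARAMETER KEPT SEPARATE: error `11·(40(4G² + 2Gω) + 12τ·‖ξ̄‖)`
# (lane A of S-BASE, crux `TwistedTraceScaling` stmt-QuantumFields-20203, C4-CORE, the (OD) pen; sub-lemma S5′ of `pub/ym-fleet/ym-luscher-20007-p1/Lines-stiff-separation.md`)

`…GaugeActionBased.norm_relLinkVec_gaugeTransform_orthoTube_sub_le'` linearises `relLinkVec((orthoTube u w)^{P∘ξ})` with error `11·(40(4G² + 2Gω) + 12τG)`, `G = sup‖ξ_x‖∞`; the last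
summand comes from the constant colour rotation `(1 − Ad(u_k))ξ̄` and is really `12τ‖ξ̄‖∞`.  The stiff-separation bootstrap (card §1, S6) runs on a based parameter after re-centring,
where `‖ξ̄‖ = O(G²)` while `G` itself is only `O(β^{-s})`: with `12τG` the error is `O(β^{-2s})`, fatal for `s < 1/4`; with `12τ‖ξ̄‖` it is second order.  THIS FILE: the same two
statements with a separate bound `‖ξ̄‖∞ ≤ G_m` (proofs verbatim from the tree, `norm_siteMean_le` replaced by the hypothesis):
* `norm_vecPart_covRel_sub_linear_le_mean` — per link `‖(covRel u ξ w e)⃗ − lin'_e‖∞ ≤ 40(4G² + 2Gω) + 12τG_m`;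
* ★★ `norm_relLinkVec_gaugeTransform_orthoTube_sub_le_mean` — `‖relLinkVec((orthoTube u w)^{P∘ξ})_{e,·} − (w_e − (D_u(ξ − ξ̄))_e)‖∞ ≤ 11·(40(4G² + 2Gω) + 12τ·G_m)`.
HONEST FRAMING: finite-dimensional algebra for a stub of a child of the CONDITIONAL route R2b1; (SEP) S1–S4, S6–S8, the hOD assembly, (B-ST), C4-CORE OPEN; not a gap, not Clay.
-/

set_option autoImplicit false

noncomputable section

open Real
open scoped BigOperators Matrix
open Literature.MathematicalPhysics.QuantumFieldTheory
open Literature.MathematicalPhysics.QuantumLattice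

namespace Summit.QuantumFields.YangMills.Theorems.FemtoTransferGap.TwoLattice.ConstTube

open Summit.QuantumFields.YangMills.Theorems.FemtoTransferGap
open Literature.Algebra.EuclideanLattices (abs_apply_le_norm)

section Main

variable {L : ℕ} [NeZero L]
variable {u : GaugeConfig 3 1 SU2} {ξ : Site 3 L → Fin 3 → ℝ} {w : Edge 3 L → Fin 3 → ℝ} {G Gm ω τ : ℝ}
  (hG : ∀ x, ‖ξ x‖ ≤ G) (hω : ∀ e, ‖w e‖ ≤ ω) (hG1 : G ≤ 1 / 40) (hω1 : ω ≤ 1 / 20)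
  (hτ1 : τ ≤ 1) (hu : ∀ (k : Fin 3) (c : Fin 3), |vecPart (u (0, k)) c| ≤ τ) (hGm : ‖siteMean L ξ‖ ≤ Gm)

include hG hω hG1 hω1 hτ1 hu hGm

/-- Per link, with the re-centred prediction `lin'_e = w_e + (ξ_x − ξ̄) − Ad(u_k)(ξ_y − ξ̄)` and a separate bound `‖ξ̄‖∞ ≤ G_m`:
`‖(covRel u ξ w e)⃗ − lin'_e‖∞ ≤ 40(4G² + 2Gω) + 12τG_m`. [folklore] -/
theorem norm_vecPart_covRel_sub_linear_le_mean (e : Edge 3 L) :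
    ‖vecPart (covRel L u ξ w e) - (w e + (ξ e.1 - siteMean L ξ) - (adRot (u (0, e.2))).mulVec (ξ (e.1.shift e.2) - siteMean L ξ))‖ ≤
      40 * (4 * G ^ 2 + 2 * G * ω) + 12 * τ * Gm := by
  have h1 := norm_vecPart_covRel_sub_linear_le hG hω hG1 hω1 (u := u) e
  have hτ0 : 0 ≤ τ := (abs_nonneg _).trans (hu 0 0)
  have hGm0 : 0 ≤ Gm := (norm_nonneg _).trans hGm
  have hm : ‖((adRot (u (0, e.2)) - 1).mulVec (siteMean L ξ))‖ ≤ 12 * τ * Gm := by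
    refine (pi_norm_le_iff_of_nonneg (by positivity)).mpr fun a => ?_
    rw [Real.norm_eq_abs]
    exact (abs_adRot_sub_one_mulVec_le _ hτ1 (hu e.2) _ a).trans (mul_le_mul_of_nonneg_left hGm (by positivity))
  have hdec : vecPart (covRel L u ξ w e) - (w e + (ξ e.1 - siteMean L ξ) - (adRot (u (0, e.2))).mulVec (ξ (e.1.shift e.2) - siteMean L ξ)) =
      (vecPart (covRel L u ξ w e) - (w e + ξ e.1 - (adRot (u (0, e.2))).mulVec (ξ (e.1.shift e.2)))) - (adRot (u (0, e.2)) - 1).mulVec (siteMean L ξ) := by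
    rw [Matrix.mulVec_sub, Matrix.sub_mulVec, Matrix.one_mulVec]; abel
  rw [hdec]
  exact (norm_sub_le _ _).trans (add_le_add h1 hm)

/-- ★★ **LINEARISATION FOR AN ARBITRARY SMALL GAUGE PARAMETER, MEAN KEPT SEPARATE**:
`‖relLinkVec((orthoTube u w)^{P∘ξ})_{e,·} − (w_e − (D_u(ξ − ξ̄))_e)‖∞ ≤ 11·(40(4G² + 2Gω) + 12τ·G_m)` for balanced `w` and `‖ξ̄‖∞ ≤ G_m`. [folklore] -/
theorem norm_relLinkVec_gaugeTransform_orthoTube_sub_le_mean (hbal : ∀ (k : Fin 3) (a : Fin 3), ∑ x : Site 3 L, w (x, k) a = 0) (e : Edge 3 L) :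
    ‖(fun a => relLinkVec L (gaugeTransform (fun x => chartSU2 (ξ x)) (orthoTube L u w)) (e, a)) - (w e - covGrad L u (fun x => ξ x - siteMean L ξ) e)‖ ≤
      11 * (40 * (4 * G ^ 2 + 2 * G * ω) + 12 * τ * Gm) := by
  have hξ1 : ∀ x, ∑ a, ξ x a ^ 2 ≤ 1 := fun x => by
    have h3 := sum_sq_le_three_norm_sq (ξ x)
    have hx : ‖ξ x‖ ≤ 1 / 40 := (hG x).trans hG1
    nlinarith [norm_nonneg (ξ x)]
  rw [gaugeTransform_orthoTube_eq L u ξ w hξ1, relLinkVec_mul_constLift L _ u (dirQuat_covRel_ne_zero hG hω hG1 hω1)]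
  have hfun : (fun a => relLinkVec L (covRel L u ξ w) (e, a)) = vecPart (covRel L u ξ w e * (polarMean L e.2 (covRel L u ξ w))⁻¹) := by
    funext a; rfl
  rw [hfun]
  have hlin' : w e - covGrad L u (fun x => ξ x - siteMean L ξ) e = w e + (ξ e.1 - siteMean L ξ) - (adRot (u (0, e.2))).mulVec (ξ (e.1.shift e.2) - siteMean L ξ) := by
    simp only [covGrad]; abel
  rw [hlin']
  exact norm_relLink_sub_lin_le (V := covRel L u ξ w)
    (lin := fun e => w e + (ξ e.1 - siteMean L ξ) - (adRot (u (0, e.2))).mulVec (ξ (e.1.shift e.2) - siteMean L ξ))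
    (ρ := 40 * (4 * G ^ 2 + 2 * G * ω) + 12 * τ * Gm) (norm_vecPart_covRel_sub_linear_le_mean hG hω hG1 hω1 hτ1 hu hGm)
    (half_le_scalarPart_covRel hG hω hG1 hω1) (sum_covLin'_eq_zero hbal) e

end Main

end Summit.QuantumFields.YangMills.Theorems.FemtoTransferGap.TwoLattice.ConstTube

end
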